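import Summits.HodgeConjecture.HodgeConjecture.Theorems.F0P3CohClassRoutingCot               -- ★ p830755 (R-32): `RoutesAt` ∕ `CohClassRoutingCot` ∕ `CohClassRoutingCotClosed` (the TYPE of the closer's `stub_L3`)
import Summits.HodgeConjecture.HodgeConjecture.Theorems.F0P3CompactTrivOfRecord              -- ★ `cmCompactFactor_rightRegular_eq_self_of_isHolOrAntihol` (`K_c` fixes every cotangent `P`)
import Summits.HodgeConjecture.HodgeConjecture.Theorems.F0P3RamClsOfRecordAntihol            -- ★ K2-cot antihol (+ ★ hol `F0P3RamClsOfRecord.eventually_exists_spherical_mem_admUnitConstituents`)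
import Summits.HodgeConjecture.HodgeConjecture.Theorems.F0P3SqNSNonsplitConsumers           -- ★ p833675: `localRouting_of_memXiFamily_of_nonsplit` (the local glue, non-split form)
import Summits.HodgeConjecture.HodgeConjecture.Theorems.F0P3SqIntNotSphericalNonsplitCofinite -- ★ p833536: `squareIntegrableNotSpherical_nonsplit_cofinite` ((SqNS♭) hypothesis-free)
import Literature.NumberTheory.Rogawski1990.CohDiscreteMemXiFamilyArchPinned                 -- ★ #80 S2♯ `cohDiscrete_memXiFamily_archPinned` + READ-BACK 1 `.memXiFamily`
import HarnessLib

/-!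
# Crux `H413` — the GUARDED routing letter (L3′) `CohClassRoutingCotClosed` FROM THE LETTER S2♯ (#80) ALONE: row #70 S2♭ leaves the T2 line

F0∕P3 «U3-mult», cell `hodgecm-mathlib`, crux item `stmt-HodgeConjecture-24833`; A-p01 (g19) on F0P3-plan (g7)'s word 2026-08-31T22:10:30Z («CENSUS L3∕S2»).
PROOF lane (theorems only; no `def`, no instance, no instance attribute, no notation, no `sorry` — the `(𝔤, K)`-token binders are only ever INTRODUCED from the ★ def
`CohClassRoutingCot`, never re-stated, so the `LieRing.ofAssociativeRing` idiom of ★ `F0P3LettersRouting` is not needed here); `--supports stmt-HodgeConjecture-24833 --as helper`.  HONEST LABEL: HC_CM is proved only modulo the printed citations until rung 0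
closes; this file discharges none of them — it RE-DENOMINATES the one letter behind the T2 pay-down line.

THE OBSERVATION.  The T2 pay-down line `Cruxes/H413/Lines/F0_T2_CohClassRoutingCotPaydown.lean` (ED. 7, 7251240d4a7e) proves the closer's `stub_L3` type
★ `F0P3CohClassRoutingCot.CohClassRoutingCotClosed` modulo EXACTLY ONE registered letter, `stub_S2 : Rogawski1990.cohDiscrete_memXiFamily` (fan-B row #70, S2♭: EVERY
token-cohomological discrete `P` of `U(H)` lies in a ξ-local family).  But the guarded letter quantifies over COTANGENT-TYPE `P` only (`IsCot P`: `P` carries a non-zero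
`K_c`-invariant holomorphic or antiholomorphic cotangent form at `ι`), and for such `P` the compact archimedean factor `K_c = cmCompactFactor` acts trivially (★
`F0P3CompactTrivOfRecord.cmCompactFactor_rightRegular_eq_self_of_isHolOrAntihol`, RULING (V31)).  These are precisely the two hypotheses (i) cotangent type, (ii) `K_c`-triviality
of the ALREADY-BOOKED letter S2♯ = fan-B row #80 ★ `Rogawski1990.cohDiscrete_memXiFamily_archPinned` (the registered stub `stub_S2sharp` of F0P2's PKΠ line), whose READ-BACK 1
★ `cohDiscrete_memXiFamily_archPinned.memXiFamily` forgets the archimedean pin and returns `∃ ξ, MemXiFamily P … ξ` — S2♭'s conclusion.  Hence the guarded letter, and its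
∀-closure over the closer's frames, follow from S2♯ ALONE over ★ theorems (K2-cot ★ `F0P3RamClsOfRecord(Antihol)`, the local glue ★ p833675 fed the hypothesis-free (SqNS♭)
★ p833536 — the same ★ terms the T2 line uses).

BOOKS CONSEQUENCE (for the desk ∕ director, not asserted by the kernel): the T2 line's next edition can read `stub_S2sharp : Rogawski1990.cohDiscrete_memXiFamily_archPinned`
(#80, already UNPROVED-booked and consumed by PKΠ) instead of `stub_S2` (#70) — `cohClassRoutingCot_closed := cohClassRoutingCotClosed_of_s2sharp stub_S2sharp` — after which
NO registered line consumes #70 `cohDiscrete_memXiFamily` by name (the closer's `hJ3a_of_letters` takes it as a HYPOTHESIS of a compatibility head only; ★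
`F0P3LettersOfClassificationShape` DERIVES it from the kit); i.e. #70 becomes WITHDRAWN-AS-ROW exactly as #71 R♭ was at v7.54.  Equivalently the closer may junction
`stub_L3 := F0P3CohClassRoutingCotOfS2Sharp.cohClassRoutingCotClosed_of_s2sharp stub_S2sharp` (registry: `stub_L3` OUT, `stub_S2sharp` IN — the SAME constant PKΠ registers).
Print behind S2♯: [Rogawski1990 Thm. 14.6.4 p. 246; §15.3 ¶1 + Prop. 15.2.1 (b) pp. 249–251; Thm. 13.3.6 (c) p. 202; §12.3 pp. 174–178; §14.6 p. 241].

* §1 `kcTrivial_of_isCot` — `IsCot P →` `K_c` fixes `P` pointwise (★ V31 theorem, re-keyed to the `IsCot` spelling).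
* §2 `cotSpherical` — K2 at cotangent type (★ hol ∕ ★ antihol), Lines-free copy of the T2 junction.
* §3 `localRouting` — the local glue ★ p833675 fed ★ (SqNS♭) p833536, Lines-free copy of T2 §1b.
* §4 HEADS `cohClassRoutingCot_of_s2sharp` (one frame) and `cohClassRoutingCotClosed_of_s2sharp : cohDiscrete_memXiFamily_archPinned → CohClassRoutingCotClosed`.
-/

set_option autoImplicit false
-- the mandated namespace repeats `HodgeConjecture.HodgeConjecture`, as in every `Theorems/*.lean` of this sub-problem
set_option linter.dupNamespace false

noncomputable section

open NumberField IsDedekindDomain MeasureTheory Filter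
open Literature.NumberTheory.Rogawski1990 Literature.NumberTheory.GaloisRepresentations
open Literature.NumberTheory.Automorphic Literature.NumberTheory.Automorphic.UnitaryGroup
open Literature.NumberTheory.Automorphic.UnitaryGroup.CotangentForms
open Literature.RepresentationTheory.BorelWallach2000 Literature.RepresentationTheory.KonnoKonno2007
open scoped Matrix Classical ComplexOrder

namespace Summit.HodgeConjecture.HodgeConjecture.Cruxes.H413.F0P3CohClassRoutingCotOfS2Sharp

open Summit.HodgeConjecture.HodgeConjecture.Cruxes.H413.F0P3InnerFormClassificationV6
open Summit.HodgeConjecture.HodgeConjecture.Cruxes.H413.F0P3ClassTokenChoice (clFinChoice admUnitConstituents)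
open Summit.HodgeConjecture.HodgeConjecture.Cruxes.H413.F0P3CohClassRoutingCot (RoutesAt CohClassRoutingCot CohClassRoutingCotClosed)

variable (L : Type) [Field L] [NumberField L] [IsCMField L] (H : Matrix (Fin 3) (Fin 3) L)
  (hH : (H.map (cmConjRingHom L))ᵀ = H) (hHd : IsUnit H.det) (μω : HeckeCharacter L) (hμu : μω.IsUnitary)
  [∀ v : HeightOneSpectrum (𝓞 ↥(maximalRealSubfield L)), MeasurableSpace (Gqs L v ⧸ Subgroup.center (Gqs L v))]
  (μZ : ∀ v : HeightOneSpectrum (𝓞 ↥(maximalRealSubfield L)), Measure (Gqs L v ⧸ Subgroup.center (Gqs L v)))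
  (keys : ∀ (ξ : OneDimAutRepH L) (v : HeightOneSpectrum (𝓞 ↥(maximalRealSubfield L))),
    (∀ w : PlacesOver L v, IsCMField.complexConj L • w.1 = w.1) →
      {p : IrrClass (Gqs L v) × IrrClass (Gqs L v) //
        KeysCaseTwoLabels L v (μω.semilocalComponent L v) (torusLocalComponent L (IsCMField.complexConj L) v ξ.η)
          (torusLocalComponent L (IsCMField.complexConj L) v ξ.ψ) p.1 p.2 ∧
        p.1.IsSquareIntegrable (μZ v) ∧ ¬ p.2.IsSquareIntegrable (μZ v)})
  (ι : L →+* ℂ) (T : GL (Fin 3) ℂ)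
  (hT : (T : Matrix (Fin 3) (Fin 3) ℂ)ᴴ * H.map ι * (T : Matrix (Fin 3) (Fin 3) ℂ) = Literature.Geometry.ComplexHyperbolic.BallModel.J)
  (μ : Measure (Gp L H).automorphicQuotient) [(Gp L H).IsAutomorphicMeasure μ]

/-! ## §1 `K_c`-triviality at cotangent type -/

omit [∀ v : HeightOneSpectrum (𝓞 ↥(maximalRealSubfield L)), MeasurableSpace (Gqs L v ⧸ Subgroup.center (Gqs L v))] in
/-- **A cotangent-type discrete `P` is `K_c`-trivial**: the compact archimedean factor `cmCompactFactor L ι H T hT` fixes `P` pointwise under the right-regular action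
(★ RULING (V31) `F0P3CompactTrivOfRecord.cmCompactFactor_rightRegular_eq_self_of_isHolOrAntihol`, re-keyed to the closer's spelling `IsCot`) — hypothesis (ii) of S2♯.
[cite: Rogawski1990, §15.3 ¶1; §14.6 p. 244] [cite: BorelJacquet1979, §4.6] -/
theorem kcTrivial_of_isCot (P : DiscreteAutomorphicRep (Gp L H) μ) (hP : IsCot L H ι T hT μ P)
    (k : (Gp L H).Adelic) (hk : k ∈ cmCompactFactor L ι H T hT) (v : P.space.toSubmodule) :
    (Gp L H).rightRegular μ k (v : (Gp L H).L2 μ) = v :=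
  F0P3CompactTrivOfRecord.cmCompactFactor_rightRegular_eq_self_of_isHolOrAntihol L ι H T hT P hP k hk v

/-! ## §2 K2 at cotangent type (Lines-free copy of the T2 junction) -/

omit [∀ v : HeightOneSpectrum (𝓞 ↥(maximalRealSubfield L)), MeasurableSpace (Gqs L v ⧸ Subgroup.center (Gqs L v))] in
/-- **K2 at cotangent type** — a holomorphic- or antiholomorphic-cotangent discrete `P` (compact CM datum: `hdef`, `h2`) has, at all but finitely many finite places, an admissible
unitarizable `K_v^H`-SPHERICAL constituent (★ hol `F0P3RamClsOfRecord.eventually_exists_spherical_mem_admUnitConstituents`, ★ antihol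
`F0P3RamClsOfRecordAntihol.eventually_exists_spherical_mem_admUnitConstituents_of_isAntiholCotangentAt`). [cite: FlathCorvallis1979, Thm. 3] [cite: Rogawski1990, §13.3 p. 201; §14.5] -/
theorem cotSpherical (hdef : ∀ τ' : L →+* ℂ, InfinitePlace.mk τ' ≠ InfinitePlace.mk ι → (H.map τ').PosDef) (h2 : 2 ≤ Module.finrank ℚ ↥(maximalRealSubfield L))
    (P : DiscreteAutomorphicRep (Gp L H) μ) (hP : IsCot L H ι T hT μ P) :
    ∀ᶠ v : HeightOneSpectrum (𝓞 ↥(maximalRealSubfield L)) in cofinite, ∃ c ∈ admUnitConstituents P v, c.IsSpherical (cmLocalIntegralLevel L 3 H v) := by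
  obtain hP | hP := (hP : P.IsHolCotangentAt (cmArchSection L ι H T hT) (cmCompactFactor L ι H T hT) ∨
      P.IsAntiholCotangentAt (cmArchSection L ι H T hT) (cmCompactFactor L ι H T hT))
  · exact F0P3RamClsOfRecord.eventually_exists_spherical_mem_admUnitConstituents ι T hT hdef h2 P hP
  · exact F0P3RamClsOfRecordAntihol.eventually_exists_spherical_mem_admUnitConstituents_of_isAntiholCotangentAt ι T hT hdef h2 P hP

/-! ## §3 The local glue (Lines-free copy of T2 §1b: ★ p833675 fed ★ (SqNS♭) p833536) -/

/-- **THE LOCAL GLUE (no letter)**: from `MemXiFamily P … ξ` and a cofinite `K_v^H`-spherical admissible unitarizable constituent, off a finite `S₁` the routing conclusion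
`RoutesAt P ξ v` holds — ★ `F0P3SqNSNonsplitConsumers.localRouting_of_memXiFamily_of_nonsplit` FED THE ★ THEOREM (SqNS♭)
`F0P3SqIntNotSphericalNonsplitCofinite.squareIntegrableNotSpherical_nonsplit_cofinite L`. [cite: Rogawski1990, §13.1 p. 199; §12.2 (2) p. 174; §14.2 pp. 233–234] [cite: Macdonald1971, Ch. V §3] -/
theorem localRouting [∀ v : HeightOneSpectrum (𝓞 ↥(maximalRealSubfield L)), BorelSpace (Gqs L v ⧸ Subgroup.center (Gqs L v))]
    [∀ v : HeightOneSpectrum (𝓞 ↥(maximalRealSubfield L)), (μZ v).IsHaarMeasure]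
    (P : DiscreteAutomorphicRep (Gp L H) μ) (ξ : OneDimAutRepH L) (hmem : MemXiFamily P hH hHd μω hμu ξ)
    (hsph : ∀ᶠ v : HeightOneSpectrum (𝓞 ↥(maximalRealSubfield L)) in cofinite,
      ∃ c ∈ admUnitConstituents P v, c.IsSpherical (cmLocalIntegralLevel L 3 H v)) :
    ∃ S₁ : Finset (Places L), ∀ v : Places L, v ∉ S₁ → RoutesAt L H hH hHd μω hμu μZ keys μ P ξ v := by
  obtain ⟨S₁, hS⟩ := F0P3SqNSNonsplitConsumers.localRouting_of_memXiFamily_of_nonsplit L H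
    (F0P3SqIntNotSphericalNonsplitCofinite.squareIntegrableNotSpherical_nonsplit_cofinite L) hH hHd μ μω hμu μZ keys P ξ hmem hsph
  exact ⟨S₁, fun v hv => hS v hv⟩

/-! ## §4 HEADS -/

/-- **`CohClassRoutingCot` FROM S2♯ (one frame)**: the token gives `ξ` with `MemXiFamily P … ξ` by S2♯'s READ-BACK 1 ★ `cohDiscrete_memXiFamily_archPinned.memXiFamily` (§1: cotangent type ⇒ `K_c`-trivial), cotangent type gives the cofinite
spherical constituent (§2), and the local glue routes (§3).  = the T2 line's `cohClassRoutingCot_holds` with `stub_S2` REPLACED by the letter #80.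
[cite: Rogawski1990, §15.3 ¶1; Thm. 13.3.6 (c) p. 202; §14.6 Thm. 14.6.4 (p. 246); §13.1 p. 199; §12.2 (2)] -/
theorem cohClassRoutingCot_of_s2sharp [∀ v : HeightOneSpectrum (𝓞 ↥(maximalRealSubfield L)), BorelSpace (Gqs L v ⧸ Subgroup.center (Gqs L v))]
    [∀ v : HeightOneSpectrum (𝓞 ↥(maximalRealSubfield L)), (μZ v).IsHaarMeasure]
    (hS2s : Literature.NumberTheory.Rogawski1990.cohDiscrete_memXiFamily_archPinned)
    (hdef : ∀ τ' : L →+* ℂ, InfinitePlace.mk τ' ≠ InfinitePlace.mk ι → (H.map τ').PosDef) (h2 : 2 ≤ Module.finrank ℚ ↥(maximalRealSubfield L))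
    (hμω : ∀ x : Literature.NumberTheory.GaloisRepresentations.ideleGroup ↥(maximalRealSubfield L),
      μω (AdeleRing.ideleBaseChange (↥(maximalRealSubfield L)) L x) = quadraticHeckeCharCM L x) :
    CohClassRoutingCot L H hH hHd μω hμu μZ keys ι T hT μ := by
  intro P hP M _ _ σK σ𝔤 hM hirr htok δ hδ hne
  -- S2♯ READ-BACK 1 at the `K_c`-triviality of §1: `∃ ξ, MemXiFamily P … ξ` (S2♭'s conclusion for this cotangent `P`)
  obtain ⟨ξ, hmem⟩ := hS2s.memXiFamily L ι H T hT hdef h2 μ μω hμu hμω P hP (kcTrivial_of_isCot L H ι T hT μ P hP) M σK σ𝔤 hM hirr htok δ hδ hne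
  exact ⟨ξ, localRouting L H hH hHd μω hμu μZ keys μ P ξ hmem (cotSpherical L H ι T hT μ hdef h2 P hP)⟩

/-- **HEAD — the closed guarded letter (the TYPE of the closer's `stub_L3`) FROM THE LETTER S2♯ ALONE**: `cohDiscrete_memXiFamily_archPinned → CohClassRoutingCotClosed`, all
closer frames at once.  Junction texts for the desk: T2 ED. 8 `cohClassRoutingCot_closed := cohClassRoutingCotClosed_of_s2sharp stub_S2sharp`; or closer
`stub_L3 := F0P3CohClassRoutingCotOfS2Sharp.cohClassRoutingCotClosed_of_s2sharp stub_S2sharp`.  Axioms = TRIO (no `sorryAx`: S2♯ is a hypothesis here).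
[cite: Rogawski1990, §15.3 ¶1; Thm. 13.3.6 (c) p. 202; §14.6 Thm. 14.6.4 (p. 246); Prop. 15.2.1 (b)] -/
theorem cohClassRoutingCotClosed_of_s2sharp (hS2s : Literature.NumberTheory.Rogawski1990.cohDiscrete_memXiFamily_archPinned) : CohClassRoutingCotClosed :=
  fun L _ _ _ ι H T hT hH hHd hdef h2 μ _ μω hμu hμω _ _ μZ _ keys =>
    cohClassRoutingCot_of_s2sharp L H hH hHd μω hμu μZ keys ι T hT μ hS2s hdef h2 hμω

end Summit.HodgeConjecture.HodgeConjecture.Cruxes.H413.F0P3CohClassRoutingCotOfS2Sharp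

end
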